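import Mathlib
import HarnessLib
import Summits.HubbardSuperconductivity.HubbardSuperconductivity.Theorems.KLProgrammeKLRegimeEngineV8IsoTupleExport

/-!
# Route `KLProgramme` — ENGINE child gen 8 (stmt-HubbardSuperconductivity-20437 `KLRegimeEngineV17F2`), class #6 / (E5-F)ₙ: what an ε-CURRENCY iso fixed-tuple line
# delivers PER SCALE (located constraint «(c)-E5-SECULAR», plan g19 (R59e)(iv); cell gate-hubbard-kl, seat hubbard-kl-k3c2-p2 g9 = class-#6 text owner)

A sign-blind producer sizes the scale-`n` quartic in ε-currency, `epsCoupling P U n = Klam·(|U| + U²·n)` (…SplitPredicatesV3).  Such a line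
`fixedTupleL1 ≤ a·epsCoupling P U n + b·(Klam U)²` IS an `IsoTupleLineAt` line AT THAT SCALE with the n-dependent constant `a·Klam·(1 + U·n)`
(`isoTupleLineAt_of_eps_line`, constant `a·Klam·(1 + U·n)` for `U ≥ 0`), so the (E5-F)ₙ door `isoTupleL1AtV17F_of_isoTupleLineAt_hist` closes scale `n` exactly when
the PER-SCALE fit `a·Klam·(1 + U·n) + b·Klam²·U ≤ G.CF/2` holds — i.e. for `U·n ≤ T` with `a·Klam·(1 + T) + b·Klam²·U ≤ G.CF/2` (`isoTupleLineAt_of_eps_line_of_mul_le`,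
`isoTupleL1AtV17F_of_eps_line_hist`).  Under `IsKLRegime` only `U²·n ≤ c/log 4` is available (`sq_mul_nScales_succ_le`), so `U·n ≤ c/(U log 4)` is unbounded as
`U → 0`: the ε-route covers all scales `n ≤ nScales β + 1` only above a U-floor — the arithmetic behind (R59e)(iv).  Pure bookkeeping; nothing about the model is asserted; nothing asserts superconductivity.
-/

noncomputable section

namespace Summit.HubbardSuperconductivity.HubbardSuperconductivity.Theorems.KLRegimeSplit

set_option linter.dupNamespace false -- summit = problem name (single-conjunct summit), D-0017

open Real Finset Literature.MathematicalPhysics.QuantumLattice Literature.Probability.LatticeModels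
open Summit.HubbardSuperconductivity.HubbardSuperconductivity.Theorems.KLProgrammeLegKernels
open Summit.HubbardSuperconductivity.HubbardSuperconductivity.Theorems.DispersionFlow
open Summit.HubbardSuperconductivity.HubbardSuperconductivity.Theorems.EngineV8

variable {L M : ℕ} [NeZero L] [NeZero M]

/-- `a·ε_n(U) = (a·Klam·(1 + |U|·n))·|U|`: the ε-currency size is U-linear AT FIXED SCALE with an n-dependent constant. -/
theorem mul_epsCoupling_eq (a : ℝ) (P : SplitConsts) (U : ℝ) (n : ℕ) :
    a * epsCoupling P U n = a * P.Klam * (1 + |U| * n) * |U| := by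
  unfold epsCoupling
  have h : U ^ 2 = |U| * |U| := by rw [← sq_abs, sq]
  rw [h]; ring

/-- **An ε-currency iso line is an `IsoTupleLineAt` line at that scale** with constant `a·Klam·(1 + U·n)` (`0 ≤ U`):
`(∀ m ≥ n, ∀ Ω, ∀ x₁, fixedTupleL1 … ≤ a·epsCoupling P U n + b·(Klam U)²) ⟹ IsoTupleLineAt L M (a·Klam·(1 + U·n)) b P β U μ n`. -/
theorem isoTupleLineAt_of_eps_line {a b : ℝ} {P : SplitConsts} {β U μ : ℝ} (hU : 0 ≤ U) {n : ℕ}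
    (h : ∀ m : ℕ, n ≤ m → ∀ Ω ∈ bgmSectorSet L M (klIsoFamily L M β μ (klFlowFrameU L M β U μ n) klE0 m) 4, ∀ x₁ : SpaceTimeIdx L M,
      fixedTupleL1 L M β 3 (klIsoKernelAt L M β U μ (klFlowFrameU L M β U μ n) n m) Ω x₁ ≤ a * epsCoupling P U n + b * (P.Klam * U) ^ 2) :
    IsoTupleLineAt L M (a * P.Klam * (1 + U * n)) b P β U μ n := by
  intro m hm Ω hΩ x₁
  have h1 := h m hm Ω hΩ x₁
  rw [mul_epsCoupling_eq, abs_of_nonneg hU] at h1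
  exact h1

/-- **The same under a bound `U·n ≤ T` on the secular product**: constant `a·Klam·(1 + T)` (monotonicity `IsoTupleLineAt.mono`). -/
theorem isoTupleLineAt_of_eps_line_of_mul_le {a b : ℝ} (ha : 0 ≤ a) {P : SplitConsts} (hK : 0 ≤ P.Klam) {β U μ : ℝ} (hU : 0 ≤ U) {n : ℕ} {T : ℝ}
    (hT : U * n ≤ T)
    (h : ∀ m : ℕ, n ≤ m → ∀ Ω ∈ bgmSectorSet L M (klIsoFamily L M β μ (klFlowFrameU L M β U μ n) klE0 m) 4, ∀ x₁ : SpaceTimeIdx L M,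
      fixedTupleL1 L M β 3 (klIsoKernelAt L M β U μ (klFlowFrameU L M β U μ n) n m) Ω x₁ ≤ a * epsCoupling P U n + b * (P.Klam * U) ^ 2) :
    IsoTupleLineAt L M (a * P.Klam * (1 + T)) b P β U μ n := by
  refine (isoTupleLineAt_of_eps_line hU h).mono hU ?_ le_rfl
  have h0 : 0 ≤ a * P.Klam := mul_nonneg ha hK
  exact mul_le_mul_of_nonneg_left (by linarith) h0

/-- **The (E5-F)ₙ door on an ε-currency line, per scale**: the door `isoTupleL1AtV17F_of_isoTupleLineAt_hist` closes scale `n` from an ε-line under the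
secular budget `U·n ≤ T` and the per-scale fit `a·Klam·(1 + T) + b·Klam²·U ≤ G.CF/2` (all other inputs as in the door). -/
theorem isoTupleL1AtV17F_of_eps_line_hist {G : GeoConsts} {P : SplitConsts} {Q : EngConsts} {R : RenConsts} {β U μ : ℝ}
    (hG : G.WF) (hP : P.WF) (hQ : Q.WF) (hR : R.WF) (hU : 0 < U) {n : ℕ} (hn1 : 1 ≤ n) (hn : n ≤ nScales β + 1) {a b T : ℝ} (ha : 0 ≤ a)
    (hT : U * n ≤ T)
    (hline : ∀ m : ℕ, n ≤ m → ∀ Ω ∈ bgmSectorSet L M (klIsoFamily L M β μ (klFlowFrameU L M β U μ n) klE0 m) 4, ∀ x₁ : SpaceTimeIdx L M,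
      fixedTupleL1 L M β 3 (klIsoKernelAt L M β U μ (klFlowFrameU L M β U μ n) n m) Ω x₁ ≤ a * epsCoupling P U n + b * (P.Klam * U) ^ 2)
    (hfit : a * P.Klam * (1 + T) + b * P.Klam ^ 2 * U ≤ G.CF / 2)
    (hhist : HistP klPredsV17F2 L M G P Q R β U μ 0 n) (hE2'' : PairValueIncrementAtV17F L M G P Q β U μ n)
    {q q₃ : TorusSite 2 L} (hq : q ∈ klBall L μ 0) (hq₃ : q₃ ∈ klBall L μ 0) (hqq : 4⁻¹ < klTorusNorm L (q + q₃))
    (hUκ : R.Gfr 0 * |U| ≤ 1 / 32 * klE0)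
    (hsmall : initDevBar G U + legDressBarQ2 G P Q U 0 4 +
        (3 * G.CF * (P.Klam * U) ^ 2 +
          ((G.cloc * P.Klam ^ 2 * (1 - (4 : ℝ) ^ (-G.θ))⁻¹ + 2 * Q.CR * P.Klam ^ 3 * |U|) * U ^ 2 + ∑ j ∈ range n, Q.CL β j / L) +
            7 / 3 * (G.CF * (P.Klam * U) ^ 2) + 20 * (Q.CR * ((P.Klam * U) ^ 2 + (P.Klam * |U|) ^ 3)) +
              4 / 3 * (Q.CR * (P.Klam * U) ^ 2)) ≤ U / 2) :
    IsoTupleL1AtV17F L M G P β U μ n :=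
  isoTupleL1AtV17F_of_isoTupleLineAt_hist hG hP hQ hR hU hn1 hn (isoTupleLineAt_of_eps_line_of_mul_le ha (zero_le_one.trans hP.1) hU.le hT hline)
    hfit hhist hE2'' hq hq₃ hqq hUκ hsmall

end Summit.HubbardSuperconductivity.HubbardSuperconductivity.Theorems.KLRegimeSplit

end
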